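import Summits.CriticalPhenomena.Ising3D.Control2DTaylorTermwise
import Mathlib.Analysis.SpecialFunctions.Pow.Real
import Mathlib.Tactic.Linarith
import Mathlib.Tactic.Positivity
import Mathlib.Tactic.Ring
import Mathlib.Tactic.LinearCombination
import HarnessLib

/-!
# OPE convergence on the open square and the four-point function are consequences of the typed sum rule
(cell `pub-ising3x`, seat controls-1 gen 42; PAPER §6.2 / Appendix E — CONTROL-ONLY; part 1 of 2, part 2 is
`Control2DParityConverse`)

HONEST FRAMING: lottery ticket; floor = tightest certified 3D Ising CFT bounds; no exact-solution
claim without a proof. CONTROL-ONLY (`d = 2`, global `sl(2) × sl(2)` blocks, `Δ_σ = s` an INPUT, axiom set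
`A2D′`); nothing here is about `d = 3`, no certificate, functional or number of the record is touched, and no
new hypothesis or named fact enters.

WHAT THIS FILE ADDS. The typed hypothesis class of the 2D control (`CrossingData.IsUnitary` +
`SatisfiesCrossing s` of `Control2DBootstrap`) imposes the `⟨σσσσ⟩` sum rule `Σ p_i F_-[g_i](z,z̄) = -F_-[1](z,z̄)`
as a pointwise `HasSum` identity on the open square `(0,1)²` and carries NO separate OPE-convergence axiom (unlike
the 3D clause A1). `Control2DTaylorTermwise` (gen 14) derived absolute convergence of `Σ p_i g_i(y,y)` on the
DIAGONAL from the sum rule alone whenever every exchanged dimension is `≥ τ₀ > 2s` (the sign of each term at the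
mirror points `x < 1/2`). Here:

* `pairPow_mono`, `hasSum_globalBlock_pair`, `globalBlock_nonneg`, **`globalBlock_mono`**, `globalBlock_le_diag`:
  for a unitary label (`ℓ ≤ Δ`) the block `g_{Δ,ℓ}(z,z̄) = Σ a_m(h) a_{m'}(h̄) (z^{h+m} z̄^{h̄+m'} + z^{h̄+m'} z̄^{h+m})`
  is a non-negative pair-monomial series, hence INCREASING IN EACH VARIABLE on the square, and
  `g(z,z̄) ≤ g(m,m)`, `m = max(z,z̄)`; so diagonal summability is summability everywhere
  (`summable_square_of_summable_diag`, `summable_square_of_lowerBound`).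
* **`CrossingData.OpeConvergent`** (`Σ p_i g_i(z,z̄)` summable at every point of the open square — absolutely,
  the terms being `≥ 0`) and **`opeConvergent_of_lowerBound`**: every unitary solution of the typed sum rule at
  `Δ_σ = s` all of whose labels have `Δ_i ≥ τ₀ > 2s` is OPE-convergent on the whole open square; corollaries
  for the typed hypotheses of record: `_of_hasScalarGap` (`U > 2s`, `s < 1`), `_of_scalarsIn` (the `A2D′` box
  `[e₁,e₂] ∪ [G,∞)`, `e₁, G > 2s`), `_of_location` (`{x₀} ∪ [G,∞)`, `x₀, G > 2s`).
* SUB-FAMILIES, no hypothesis on the low scalars: `opeConvergent_on` (any label set bounded below by `τ₀ > 2s`),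
  **`opeConvergent_tail`** (`{i : Δ_i ≥ τ₀}`), **`opeConvergent_spinning`** (`{i : ℓ_i ≠ 0}`, `s < 1`, since
  `Δ ≥ ℓ ≥ 2`), `opeConvergent_of_finite_low` (finitely many labels below `τ₀` suffice for the whole expansion).
* **The four-point function** `CrossingData.fourPoint D z z̄ := 1 + Σ' p_i g_i(z,z̄)` (the identity plus the
  `s`-channel sum; an unconditional `tsum`, meaningful under `OpeConvergent`): `one_le_fourPoint`, `fourPoint_swap`
  (symmetric under `z ↔ z̄` — the typed expansion is parity-symmetric), **`fourPoint_crossing`**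
  (`v^s G(z,z̄) = u^s G(1-z,1-z̄)` from the sum rule + convergence), `satisfiesCrossing_of_fourPoint` (the
  converse, no gap needed) and **`satisfiesCrossing_iff_fourPoint`**: for unitary data with `Δ_i ≥ τ₀ > 2s` the
  typed sum rule IS «the `s`-channel expansion converges on the open square and its sum is crossing-symmetric
  there» — with the convergence clause a THEOREM of the typed class, not an input.

NOT claimed: OPE convergence for typed data with a scalar location `x₀ ≤ 2s` (not derived here and not claimed
false — it would need the boundary asymptotics of `k_{2h}`); convergence anywhere off the REAL open square (no
complex domain, no `ρ`-coordinates); that `fourPoint` is the correlator of a CFT (it is DEFINED from the datum);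
anything about Virasoro symmetry; anything three-dimensional; any new bound.

References: R. Rattazzi, V. S. Rychkov, E. Tonni, A. Vichi, JHEP 12 (2008) 031, §3 eq. (3.3)–(3.6) (crossing
`v^Δ G(u,v) = u^Δ G(v,u)` and the sum rule) [cite: RattazziEtAl2008, §3]; D. Pappadopulo, S. Rychkov, J. Espin,
R. Rattazzi, Phys. Rev. D 86 (2012) 105043, §4 (OPE convergence — an INPUT there, an OUTPUT of the typed class
here); F. A. Dolan, H. Osborn, Nucl. Phys. B 678 (2004) 491, §3 [cite: DolanOsborn2004, §3]. Tree:
`pairPow`, `hasSum_blockPair`, `chiralCoeff_nonneg` (`Control2DTermwise`); `summable_diag_of_lowerBound`,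
`summable_diag_of_summable_crossF`, `summable_diag_all`, `CrossingData.two_le_of_spin_ne_zero`,
`lowerBound_of_hasScalarGap`, `lowerBound_of_scalarsIn` (`Control2DTaylorTermwise`); `ScalarsIn`
(`Control2DIsland`); `crossF` (`Literature/…/ConformalBootstrap3D/SigmaEpsilonSystem`). Mathlib: `hasSum_le`,
`Summable.of_nonneg_of_le`, `Summable.subtype`, `summable_subtype_and_compl`, `Set.Finite.summable`,
`HasSum.unique`, `Real.rpow_le_rpow`.
-/

namespace Summit.CriticalPhenomena.Ising3D.Control2D

open Set
open Literature.MathematicalPhysics.QuantumFieldTheory.ConformalBootstrap3D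

/-! ### Off-diagonal domination: the block is increasing in each variable -/

/-- The pair monomial `x^a y^b + x^b y^a` with `a, b ≥ 0` is increasing in each variable on `[0, ∞)`.
[folklore] -/
theorem pairPow_mono {a b x y x' y' : ℝ} (ha : 0 ≤ a) (hb : 0 ≤ b) (hx : 0 ≤ x) (hy : 0 ≤ y)
    (hxx' : x ≤ x') (hyy' : y ≤ y') : pairPow a b x y ≤ pairPow a b x' y' := by
  have hx' : 0 ≤ x' := hx.trans hxx'
  have h1 : x ^ a ≤ x' ^ a := Real.rpow_le_rpow hx hxx' ha
  have h2 : y ^ b ≤ y' ^ b := Real.rpow_le_rpow hy hyy' hb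
  have h3 : x ^ b ≤ x' ^ b := Real.rpow_le_rpow hx hxx' hb
  have h4 : y ^ a ≤ y' ^ a := Real.rpow_le_rpow hy hyy' ha
  have h5 : x ^ a * y ^ b ≤ x' ^ a * y' ^ b :=
    mul_le_mul h1 h2 (Real.rpow_nonneg hy b) (Real.rpow_nonneg hx' a)
  have h6 : x ^ b * y ^ a ≤ x' ^ b * y' ^ a :=
    mul_le_mul h3 h4 (Real.rpow_nonneg hy a) (Real.rpow_nonneg hx' b)
  unfold pairPow
  linarith

/-- **The block as a non-negative pair-monomial series at a point of the square** (`hasSum_blockPair` read for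
`globalBlock`): for `ℓ ≤ Δ`, `g_{Δ,ℓ}(z,z̄) = Σ_{m,m'} a_m(h) a_{m'}(h̄) · pairPow (h+m) (h̄+m') (z,z̄)`,
`h = (Δ+ℓ)/2`, `h̄ = (Δ-ℓ)/2`. [cite: DolanOsborn2004, §3] -/
theorem hasSum_globalBlock_pair {Δ : ℝ} {ℓ : ℕ} (hΔ : (ℓ : ℝ) ≤ Δ) {z zb : ℝ} (hz : z ∈ Ioo (0 : ℝ) 1)
    (hzb : zb ∈ Ioo (0 : ℝ) 1) :
    HasSum (fun mm : ℕ × ℕ => chiralCoeff ((Δ + ℓ) / 2) mm.1 * chiralCoeff ((Δ - ℓ) / 2) mm.2 *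
        pairPow ((Δ + ℓ) / 2 + (mm.1 : ℝ)) ((Δ - ℓ) / 2 + (mm.2 : ℝ)) z zb) (globalBlock Δ ℓ z zb) := by
  have hℓ : (0 : ℝ) ≤ ℓ := Nat.cast_nonneg ℓ
  have hval : globalBlock Δ ℓ z zb = chiralBlock ((Δ + ℓ) / 2) z * chiralBlock ((Δ - ℓ) / 2) zb +
      chiralBlock ((Δ - ℓ) / 2) z * chiralBlock ((Δ + ℓ) / 2) zb := rfl
  rw [hval]
  exact hasSum_blockPair (by linarith) (by linarith) hz hzb

/-- `g_{Δ,ℓ}(z,z̄) ≥ 0` on the open square for a unitary label `ℓ ≤ Δ`. [folklore] -/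
theorem globalBlock_nonneg {Δ : ℝ} {ℓ : ℕ} (hΔ : (ℓ : ℝ) ≤ Δ) {z zb : ℝ} (hz : z ∈ Ioo (0 : ℝ) 1)
    (hzb : zb ∈ Ioo (0 : ℝ) 1) : 0 ≤ globalBlock Δ ℓ z zb := by
  have hℓ : (0 : ℝ) ≤ ℓ := Nat.cast_nonneg ℓ
  refine (hasSum_globalBlock_pair hΔ hz hzb).nonneg fun mm => ?_
  exact mul_nonneg (mul_nonneg (chiralCoeff_nonneg (by linarith) _) (chiralCoeff_nonneg (by linarith) _))
    (pairPow_nonneg' _ _ hz.1.le hzb.1.le)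
where
  /-- `pairPow a b x y ≥ 0` for `x, y ≥ 0` (local copy; `Control2DTail.pairPow_nonneg` is not in this file's
  import closure). [folklore] -/
  pairPow_nonneg' (a b : ℝ) {x y : ℝ} (hx : 0 ≤ x) (hy : 0 ≤ y) : 0 ≤ pairPow a b x y := by
    unfold pairPow; positivity

/-- **Monotonicity of the block in each variable**: for a unitary label and `0 < z ≤ z' < 1`,
`0 < z̄ ≤ z̄' < 1`, `g_{Δ,ℓ}(z,z̄) ≤ g_{Δ,ℓ}(z',z̄')` — every pair monomial has exponents `h+m, h̄+m' ≥ 0`.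
[folklore] -/
theorem globalBlock_mono {Δ : ℝ} {ℓ : ℕ} (hΔ : (ℓ : ℝ) ≤ Δ) {z zb z' zb' : ℝ} (hz : 0 < z) (hzb : 0 < zb)
    (hzz' : z ≤ z') (hzbzb' : zb ≤ zb') (hz' : z' < 1) (hzb' : zb' < 1) :
    globalBlock Δ ℓ z zb ≤ globalBlock Δ ℓ z' zb' := by
  have hℓ : (0 : ℝ) ≤ ℓ := Nat.cast_nonneg ℓ
  have hh : 0 ≤ (Δ + ℓ) / 2 := by linarith
  have hhb : 0 ≤ (Δ - ℓ) / 2 := by linarith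
  refine hasSum_le (fun mm => ?_) (hasSum_globalBlock_pair hΔ ⟨hz, lt_of_le_of_lt hzz' hz'⟩
    ⟨hzb, lt_of_le_of_lt hzbzb' hzb'⟩)
    (hasSum_globalBlock_pair hΔ ⟨lt_of_lt_of_le hz hzz', hz'⟩ ⟨lt_of_lt_of_le hzb hzbzb', hzb'⟩)
  have ha : 0 ≤ chiralCoeff ((Δ + ℓ) / 2) mm.1 * chiralCoeff ((Δ - ℓ) / 2) mm.2 :=
    mul_nonneg (chiralCoeff_nonneg hh _) (chiralCoeff_nonneg hhb _)
  have h1 : (0 : ℝ) ≤ mm.1 := Nat.cast_nonneg _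
  have h2 : (0 : ℝ) ≤ mm.2 := Nat.cast_nonneg _
  exact mul_le_mul_of_nonneg_left
    (pairPow_mono (by linarith) (by linarith) hz.le hzb.le hzz' hzbzb') ha

/-- **Off-diagonal domination**: `g_{Δ,ℓ}(z,z̄) ≤ g_{Δ,ℓ}(m,m)` with `m = max(z,z̄)`, a diagonal point of the
square. [folklore] -/
theorem globalBlock_le_diag {Δ : ℝ} {ℓ : ℕ} (hΔ : (ℓ : ℝ) ≤ Δ) {z zb : ℝ} (hz : z ∈ Ioo (0 : ℝ) 1)
    (hzb : zb ∈ Ioo (0 : ℝ) 1) : globalBlock Δ ℓ z zb ≤ globalBlock Δ ℓ (max z zb) (max z zb) :=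
  globalBlock_mono hΔ hz.1 hzb.1 (le_max_left _ _) (le_max_right _ _) (max_lt hz.2 hzb.2)
    (max_lt hz.2 hzb.2)

/-- The block is symmetric under `z ↔ z̄` (the typed expansion is parity-symmetric by construction). [folklore] -/
theorem globalBlock_swap (Δ : ℝ) (ℓ : ℕ) (z zb : ℝ) : globalBlock Δ ℓ zb z = globalBlock Δ ℓ z zb := by
  simp only [globalBlock]; ring

/-! ### From the diagonal to the whole square (family form) -/

/-- **Diagonal summability is summability everywhere**: for unitary blocks with weights `p_i ≥ 0`, if
`Σ p_i g_i(y,y) < ∞` at every diagonal point then `Σ p_i g_i(z,z̄) < ∞` at every point of the open square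
(comparison at `y = max(z,z̄)`). [folklore] -/
theorem summable_square_of_summable_diag {ι : Type*} {Δ : ι → ℝ} {spin : ι → ℕ} {p : ι → ℝ}
    (hunit : ∀ i, (spin i : ℝ) ≤ Δ i) (hp : ∀ i, 0 ≤ p i)
    (h : ∀ y : ℝ, y ∈ Ioo (0 : ℝ) 1 → Summable fun i => p i * globalBlock (Δ i) (spin i) y y)
    {z zb : ℝ} (hz : z ∈ Ioo (0 : ℝ) 1) (hzb : zb ∈ Ioo (0 : ℝ) 1) :
    Summable fun i => p i * globalBlock (Δ i) (spin i) z zb :=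
  (h (max z zb) ⟨lt_max_of_lt_left hz.1, max_lt hz.2 hzb.2⟩).of_nonneg_of_le
    (fun i => mul_nonneg (hp i) (globalBlock_nonneg (hunit i) hz hzb))
    (fun i => mul_le_mul_of_nonneg_left (globalBlock_le_diag (hunit i) hz hzb) (hp i))

/-- **OPE convergence on the whole square from the sum rule** (family form): unitary blocks with `p_i ≥ 0`, all
of dimension `Δ_i ≥ τ₀ > 2s`, whose sum-rule terms `p_i F^{s}_-[g_i](x,x)` are summable at every diagonal point
`x < 1/2`, have `Σ p_i g_i(z,z̄) < ∞` at every point of the open square (`summable_diag_of_lowerBound` + the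
domination above). [cite: RattazziEtAl2008, §3] -/
theorem summable_square_of_lowerBound {ι : Type*} {Δ : ι → ℝ} {spin : ι → ℕ} {p : ι → ℝ} {s τ₀ : ℝ}
    (hunit : ∀ i, (spin i : ℝ) ≤ Δ i) (hp : ∀ i, 0 ≤ p i) (hτ : ∀ i, τ₀ ≤ Δ i) (hτ₀ : 2 * s < τ₀)
    (hcross : ∀ x : ℝ, 0 < x → x < 1 / 2 →
      Summable fun i => p i * crossF s (-1) (globalBlock (Δ i) (spin i)) x x)
    {z zb : ℝ} (hz : z ∈ Ioo (0 : ℝ) 1) (hzb : zb ∈ Ioo (0 : ℝ) 1) :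
    Summable fun i => p i * globalBlock (Δ i) (spin i) z zb :=
  summable_square_of_summable_diag hunit hp
    (fun _ hy => summable_diag_of_lowerBound hunit hp hτ hτ₀ hcross hy) hz hzb

/-! ### OPE convergence of a typed datum -/

namespace CrossingData

variable {D : CrossingData} {s : ℝ}

/-- **OPE convergence on the open square**: the `s`-channel expansion `Σ_i p_i g_{Δ_i,ℓ_i}(z,z̄)` of the datum is
summable at every real point `z, z̄ ∈ (0,1)` (absolutely: for unitary data every term is `≥ 0`). In the typed 2D
class this is NOT an axiom; the theorems below derive it. [cite: RattazziEtAl2008, §3] -/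
def OpeConvergent (D : CrossingData) : Prop :=
  ∀ z zb : ℝ, z ∈ Ioo (0 : ℝ) 1 → zb ∈ Ioo (0 : ℝ) 1 →
    Summable fun i => D.p i * globalBlock (D.Δ i) (D.spin i) z zb

/-- **OPE convergence from the typed sum rule under a uniform lower bound `Δ_i ≥ τ₀ > 2Δ_σ`.** Every unitary
solution of the typed `⟨σσσσ⟩` sum rule at `Δ_σ = s` all of whose exchanged dimensions are `≥ τ₀ > 2s` has its
`s`-channel expansion absolutely convergent at EVERY point of the open square. [cite: RattazziEtAl2008, §3] -/
theorem opeConvergent_of_lowerBound (hU : D.IsUnitary) (hC : D.SatisfiesCrossing s) {τ₀ : ℝ}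
    (hτ : ∀ i, τ₀ ≤ D.Δ i) (hτ₀ : 2 * s < τ₀) : D.OpeConvergent := fun _ _ hz hzb =>
  summable_square_of_lowerBound (fun i => (hU i).2.1) (fun i => (hU i).2.2) hτ hτ₀
    (fun x hx0 hx2 => (hC x x ⟨hx0, by linarith⟩ ⟨hx0, by linarith⟩).summable) hz hzb

/-- **OPE convergence in the branch of a gap statement**: scalar gap `U > 2s` and `s < 1` (spinning labels have
`Δ ≥ ℓ ≥ 2 > 2s`). [cite: RattazziEtAl2008, §5] -/
theorem opeConvergent_of_hasScalarGap (hU : D.IsUnitary) (hC : D.SatisfiesCrossing s) {U : ℝ}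
    (hgap : D.HasScalarGap U) (hU2 : 2 * s < U) (hs1 : s < 1) : D.OpeConvergent :=
  opeConvergent_of_lowerBound hU hC (lowerBound_of_hasScalarGap hU hgap) (lt_min hU2 (by linarith))

/-- **OPE convergence in the branch of an `A2D′` box statement**: scalars in `[e₁,e₂] ∪ [G,∞)` with `e₁ > 2s`,
`G > 2s`, `s < 1`. [cite: RattazziEtAl2008, §5] -/
theorem opeConvergent_of_scalarsIn (hU : D.IsUnitary) (hC : D.SatisfiesCrossing s) {e₁ e₂ G : ℝ}
    (hS : D.ScalarsIn (Icc e₁ e₂ ∪ Ici G)) (he : 2 * s < e₁) (hG : 2 * s < G) (hs1 : s < 1) :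
    D.OpeConvergent :=
  opeConvergent_of_lowerBound hU hC (lowerBound_of_scalarsIn hU hS) (lt_min (lt_min he hG) (by linarith))

/-- The single-location hypothesis "scalars in `{x₀} ∪ [G,∞)`" gives the uniform lower bound `min (min x₀ G) 2`.
[folklore] -/
theorem lowerBound_of_location (hU : D.IsUnitary) {x₀ G : ℝ} (hS : D.ScalarsIn ({x₀} ∪ Ici G)) (i : D.ι) :
    min (min x₀ G) 2 ≤ D.Δ i := by
  by_cases h0 : D.spin i = 0
  · rcases hS i h0 with hx | hG
    · rw [mem_singleton_iff] at hx
      exact (min_le_left _ _).trans ((min_le_left _ _).trans hx.ge)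
    · exact (min_le_left _ _).trans ((min_le_right _ _).trans hG)
  · exact (min_le_right _ _).trans (two_le_of_spin_ne_zero hU h0)

/-- **OPE convergence in the branch of a single-location statement** (`ExcludedAt` / `TwoSided` /
`ControlDataSet`): scalars in `{x₀} ∪ [G,∞)` with `x₀ > 2s`, `G > 2s`, `s < 1`. [cite: RattazziEtAl2008, §5] -/
theorem opeConvergent_of_location (hU : D.IsUnitary) (hC : D.SatisfiesCrossing s) {x₀ G : ℝ}
    (hS : D.ScalarsIn ({x₀} ∪ Ici G)) (hx : 2 * s < x₀) (hG : 2 * s < G) (hs1 : s < 1) :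
    D.OpeConvergent :=
  opeConvergent_of_lowerBound hU hC (lowerBound_of_location hU hS) (lt_min (lt_min hx hG) (by linarith))

/-! ### Sub-families: the tail and the spinning operators converge with no hypothesis on the low scalars -/

/-- **Every label set bounded below by `τ₀ > 2s` has convergent expansion on the square**, for ANY unitary
solution of the typed sum rule (a sub-family of a summable real family is summable, and the sign argument runs
inside the sub-family). [cite: RattazziEtAl2008, §3] -/
theorem opeConvergent_on (hU : D.IsUnitary) (hC : D.SatisfiesCrossing s) {τ₀ : ℝ} (hτ₀ : 2 * s < τ₀)
    (T : Set D.ι) (hT : ∀ i ∈ T, τ₀ ≤ D.Δ i) {z zb : ℝ} (hz : z ∈ Ioo (0 : ℝ) 1) (hzb : zb ∈ Ioo (0 : ℝ) 1) :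
    Summable fun i : T => D.p i * globalBlock (D.Δ i) (D.spin i) z zb :=
  summable_square_of_lowerBound (ι := T) (fun i => (hU i).2.1) (fun i => (hU i).2.2) (fun i => hT i i.2) hτ₀
    (fun x hx0 hx2 => (hC x x ⟨hx0, by linarith⟩ ⟨hx0, by linarith⟩).summable.subtype _) hz hzb

/-- **The high-dimension tail of every typed solution converges absolutely on the open square**: for any
`τ₀ > 2s`, `Σ_{Δ_i ≥ τ₀} p_i g_i(z,z̄) < ∞` at every point, whatever the labels below `τ₀` are.
[cite: RattazziEtAl2008, §3] -/
theorem opeConvergent_tail (hU : D.IsUnitary) (hC : D.SatisfiesCrossing s) {τ₀ : ℝ} (hτ₀ : 2 * s < τ₀)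
    {z zb : ℝ} (hz : z ∈ Ioo (0 : ℝ) 1) (hzb : zb ∈ Ioo (0 : ℝ) 1) :
    Summable fun i : ↥{i : D.ι | τ₀ ≤ D.Δ i} => D.p i * globalBlock (D.Δ i) (D.spin i) z zb :=
  opeConvergent_on hU hC hτ₀ _ (fun _ hi => hi) hz hzb

/-- **The spinning operators of every typed solution converge absolutely on the open square** when `s < 1`
(2D unitarity: `ℓ ≠ 0` even ⇒ `Δ ≥ ℓ ≥ 2 > 2s`); no hypothesis on the scalars at all. [cite: RattazziEtAl2008, §3] -/
theorem opeConvergent_spinning (hU : D.IsUnitary) (hC : D.SatisfiesCrossing s) (hs1 : s < 1) {z zb : ℝ}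
    (hz : z ∈ Ioo (0 : ℝ) 1) (hzb : zb ∈ Ioo (0 : ℝ) 1) :
    Summable fun i : ↥{i : D.ι | D.spin i ≠ 0} => D.p i * globalBlock (D.Δ i) (D.spin i) z zb :=
  opeConvergent_on hU hC (τ₀ := 2) (by linarith) _ (fun _ hi => two_le_of_spin_ne_zero hU hi) hz hzb

/-- **Finitely many labels below `τ₀ > 2s` suffice** for OPE convergence of the whole expansion on the square
(the finite part trivially, the rest by `opeConvergent_on`). [cite: RattazziEtAl2008, §3] -/
theorem opeConvergent_of_finite_low (hU : D.IsUnitary) (hC : D.SatisfiesCrossing s) {τ₀ : ℝ}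
    (hτ₀ : 2 * s < τ₀) (hfin : ({i : D.ι | D.Δ i < τ₀} : Set D.ι).Finite) : D.OpeConvergent := by
  intro z zb hz hzb
  refine (summable_subtype_and_compl (f := fun i => D.p i * globalBlock (D.Δ i) (D.spin i) z zb)
    (s := ({i : D.ι | D.Δ i < τ₀} : Set D.ι))).mp ⟨?_, ?_⟩
  · exact hfin.summable (fun i => D.p i * globalBlock (D.Δ i) (D.spin i) z zb)
  · exact opeConvergent_on hU hC hτ₀ _ (fun i hi => not_lt.mp hi) hz hzb

/-! ### The four-point function and crossing symmetry -/

/-- **The four-point function of the datum on the open square**: `G(z,z̄) = 1 + Σ'_i p_i g_{Δ_i,ℓ_i}(z,z̄)` — the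
identity contribution plus the `s`-channel sum (an unconditional `tsum`; it is the sum of the series exactly when
the expansion converges, `OpeConvergent`). Rattazzi–Rychkov–Tonni–Vichi 2008, eq. (3.3). [cite: RattazziEtAl2008, §3] -/
noncomputable def fourPoint (D : CrossingData) (z zb : ℝ) : ℝ :=
  1 + ∑' i, D.p i * globalBlock (D.Δ i) (D.spin i) z zb

/-- `G(z,z̄) ≥ 1` on the square for unitary data (every term of the `s`-channel sum is `≥ 0`). [folklore] -/
theorem one_le_fourPoint (hU : D.IsUnitary) {z zb : ℝ} (hz : z ∈ Ioo (0 : ℝ) 1) (hzb : zb ∈ Ioo (0 : ℝ) 1) :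
    1 ≤ D.fourPoint z zb := by
  have h : 0 ≤ ∑' i, D.p i * globalBlock (D.Δ i) (D.spin i) z zb :=
    tsum_nonneg fun i => mul_nonneg (hU i).2.2 (globalBlock_nonneg (hU i).2.1 hz hzb)
  unfold fourPoint
  linarith

/-- `G(z̄,z) = G(z,z̄)`: the typed four-point function is symmetric under `z ↔ z̄`. [folklore] -/
theorem fourPoint_swap (D : CrossingData) (z zb : ℝ) : D.fourPoint zb z = D.fourPoint z zb := by
  unfold fourPoint
  simp only [globalBlock_swap]

/-- The sum-rule family is `v^s ·` (the expansion at `(z,z̄)`) minus `u^s ·` (the expansion at `(1-z,1-z̄)`): under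
OPE convergence at both points it has the sum `v^s (G(z,z̄) - 1) - u^s (G(1-z,1-z̄) - 1)`. [folklore] -/
theorem hasSum_crossF_of_opeConvergent (hconv : D.OpeConvergent) {z zb : ℝ} (hz : z ∈ Ioo (0 : ℝ) 1)
    (hzb : zb ∈ Ioo (0 : ℝ) 1) :
    HasSum (fun i => D.p i * crossF s (-1) (globalBlock (D.Δ i) (D.spin i)) z zb)
      (((1 - z) * (1 - zb)) ^ s * (D.fourPoint z zb - 1) -
        (z * zb) ^ s * (D.fourPoint (1 - z) (1 - zb) - 1)) := by
  have hz' : 1 - z ∈ Ioo (0 : ℝ) 1 := ⟨by linarith [hz.2], by linarith [hz.1]⟩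
  have hzb' : 1 - zb ∈ Ioo (0 : ℝ) 1 := ⟨by linarith [hzb.2], by linarith [hzb.1]⟩
  have A := (hconv z zb hz hzb).hasSum
  have B := (hconv (1 - z) (1 - zb) hz' hzb').hasSum
  have hA : D.fourPoint z zb - 1 = ∑' i, D.p i * globalBlock (D.Δ i) (D.spin i) z zb := by
    unfold fourPoint; ring
  have hB : D.fourPoint (1 - z) (1 - zb) - 1 =
      ∑' i, D.p i * globalBlock (D.Δ i) (D.spin i) (1 - z) (1 - zb) := by
    unfold fourPoint; ring
  rw [hA, hB]
  refine ((A.mul_left (((1 - z) * (1 - zb)) ^ s)).sub (B.mul_left ((z * zb) ^ s))).congr_fun fun i => ?_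
  simp only [crossF]
  ring

/-- **Crossing symmetry of the four-point function**: a solution of the typed sum rule at `Δ_σ = s` whose
expansion converges on the open square satisfies `v^s G(z,z̄) = u^s G(1-z,1-z̄)` at every point of the square,
`u = z z̄`, `v = (1-z)(1-z̄)` (the sum rule is this identity with the identity operator moved to the right).
Rattazzi–Rychkov–Tonni–Vichi 2008, eq. (3.3) ⇔ (3.6). [cite: RattazziEtAl2008, §3 eq. (3.3)] -/
theorem fourPoint_crossing (hC : D.SatisfiesCrossing s) (hconv : D.OpeConvergent) {z zb : ℝ}
    (hz : z ∈ Ioo (0 : ℝ) 1) (hzb : zb ∈ Ioo (0 : ℝ) 1) :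
    ((1 - z) * (1 - zb)) ^ s * D.fourPoint z zb = (z * zb) ^ s * D.fourPoint (1 - z) (1 - zb) := by
  have h := (hasSum_crossF_of_opeConvergent (s := s) hconv hz hzb).unique (hC z zb hz hzb)
  simp only [crossF] at h
  linear_combination h

/-- **The converse: a convergent crossing-symmetric expansion solves the typed sum rule** (no gap hypothesis).
[cite: RattazziEtAl2008, §3 eq. (3.6)] -/
theorem satisfiesCrossing_of_fourPoint (hconv : D.OpeConvergent)
    (hX : ∀ z zb : ℝ, z ∈ Ioo (0 : ℝ) 1 → zb ∈ Ioo (0 : ℝ) 1 →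
      ((1 - z) * (1 - zb)) ^ s * D.fourPoint z zb = (z * zb) ^ s * D.fourPoint (1 - z) (1 - zb)) :
    D.SatisfiesCrossing s := by
  intro z zb hz hzb
  have h := hasSum_crossF_of_opeConvergent (s := s) hconv hz hzb
  have hval : ((1 - z) * (1 - zb)) ^ s * (D.fourPoint z zb - 1) -
      (z * zb) ^ s * (D.fourPoint (1 - z) (1 - zb) - 1) = -(crossF s (-1) (fun _ _ => (1 : ℝ)) z zb) := by
    simp only [crossF]
    linear_combination hX z zb hz hzb
  rw [hval] at h
  exact h

/-- **The typed sum rule IS crossing symmetry of a convergent expansion.** For unitary data all of whose labels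
have `Δ_i ≥ τ₀ > 2s`: `SatisfiesCrossing s` ⇔ (the `s`-channel expansion converges at every point of the open
square ∧ `v^s G(z,z̄) = u^s G(1-z,1-z̄)` there). WHICH DIRECTION USES WHAT: (⇒) uses unitarity AND the lower bound
`Δ_i ≥ τ₀ > 2s` — they give absolute convergence on the square by the sign argument (`opeConvergent_of_lowerBound`),
after which `fourPoint_crossing` is algebra; (⇐) is the definitional unfolding `satisfiesCrossing_of_fourPoint` and
uses neither unitarity nor the lower bound. The equivalence is therefore NOT hypothesis-free: the convergence clause
on the right is a consequence of the typed hypothesis only together with unitarity and the gap `τ₀ > 2s`.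
[cite: RattazziEtAl2008, §3] -/
theorem satisfiesCrossing_iff_fourPoint (hU : D.IsUnitary) {τ₀ : ℝ} (hτ : ∀ i, τ₀ ≤ D.Δ i)
    (hτ₀ : 2 * s < τ₀) :
    D.SatisfiesCrossing s ↔
      D.OpeConvergent ∧ ∀ z zb : ℝ, z ∈ Ioo (0 : ℝ) 1 → zb ∈ Ioo (0 : ℝ) 1 →
        ((1 - z) * (1 - zb)) ^ s * D.fourPoint z zb = (z * zb) ^ s * D.fourPoint (1 - z) (1 - zb) :=
  ⟨fun hC => ⟨opeConvergent_of_lowerBound hU hC hτ hτ₀, fun _ _ hz hzb =>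
      fourPoint_crossing hC (opeConvergent_of_lowerBound hU hC hτ hτ₀) hz hzb⟩,
    fun h => satisfiesCrossing_of_fourPoint h.1 h.2⟩

/-- **The gap branch, packaged**: for unitary data with a scalar gap `U > 2s` (`s < 1`, so every label is above
`min U 2 > 2s`) the typed sum rule is equivalent to convergence + crossing symmetry of `G` on the open square; as in
`satisfiesCrossing_iff_fourPoint`, (⇒) uses unitarity and the gap, (⇐) uses neither. [cite: RattazziEtAl2008, §3] -/
theorem satisfiesCrossing_iff_fourPoint_of_hasScalarGap (hU : D.IsUnitary) {U : ℝ} (hgap : D.HasScalarGap U)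
    (hU2 : 2 * s < U) (hs1 : s < 1) :
    D.SatisfiesCrossing s ↔
      D.OpeConvergent ∧ ∀ z zb : ℝ, z ∈ Ioo (0 : ℝ) 1 → zb ∈ Ioo (0 : ℝ) 1 →
        ((1 - z) * (1 - zb)) ^ s * D.fourPoint z zb = (z * zb) ^ s * D.fourPoint (1 - z) (1 - zb) :=
  satisfiesCrossing_iff_fourPoint hU (lowerBound_of_hasScalarGap hU hgap) (lt_min hU2 (by linarith))

end CrossingData

end Summit.CriticalPhenomena.Ising3D.Control2D
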